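import Summits.ABC.IUTFork.Repair.RHLatticeLevelWindow
import Summits.ABC.IUTFork.Repair.RHHullThresholdExactRefute
import HarnessLib

/-!
# D-0079 RESCUE R-H, ROW 18 «lattice-level-window» on the NEGATIVE side: wherever row 4's closed-form column FAILS at the certified radii of
# ONE tame bad place (realising ideles), the candidate `HStarLatticeLevelWindow` is FALSE — its k3 «window compatibility» is a kernel implication

PROOF-ONLY file (D-0012: 0 definitions, 0 `Prop` facts; abc-iut cell, rung LADDER-ABC:A2.RESCUE.H; seat abc-iut-rh-tst-4 = R-H ROUND 1 PAIR
n = 4 TESTER, rows 4 / 18 of `plan/rescue/R-H/RH-CANDIDATES.tsv`; tester evidence, round-2 machinery — no ROUND1 word changes). TAKES NO SIDE on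
[IUTchIII] Cor. 3.12 or on any author: every statement is about OUR typed objects (abc-iut-c312-7's `Thm311.Real.settingPrVolSharp`,
abc-iut-c312-5's `presAt` / typed (Ind1)(Ind2), the hull-level licence = a STRONGER-THAN-PRINT reading of Step (xi-f)); `HStarLatticeLevelWindow`
(author abc-iut-lens-nearmiss-2, file p460671) is a HYPOTHESIS, never asserted; typed ≠ proved; refuted-as-typed ≠ refuted-in-print; nothing
here asserts abc proved or refuted.

WHAT. Two ACCEPTED theorems with verbatim-identical `hSHw`-shaped conclusions are composed:
* p460671 `RH.LatticeLevelWindow.exists_qPinned_and_hull_settingPrVolSharp_of_levelWindow'`: `HStarLatticeLevelWindow X tq t ⟹ ∃ ρ qK,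
  QPinned ∧ PilotKummerCompatHull` at `settingPrVolSharp X …` (M1 discharged in-file by abc-iut-w5-d180's `exists_mem_ismDH_apply_eq_of_primitive`);
* p462895 `RH.HullThresholdExactRefute.not_exists_qPinned_and_hull_settingPrVolSharp_of_not_hullCell` (abc-iut-rh-typ-4): realising Θ- and q-ideles,
  abc-iut-w4-d036's radius binders `cin/cout` (`hin0/hin/hmax/hout0/houtΛ/hdom`), ONE place `w | p` with integral `P_q(w) = P`, certified radii
  bounds `(hcin) p^{−r_in_ub/e_w} ≤ ‖cin w‖`, `(hcout) ‖cout w‖ ≤ p^{−r_out_lb/e_w}`, tame different defect `(hd)` of the diagonal packet, and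
  `(hneg) ¬ HullCell e_w P (i+1) r_in_ub r_out_lb` ⟹ `¬ ∃ ρ qK, QPinned ∧ PilotKummerCompatHull` at the same setting.
HENCE **`hStarLatticeLevelWindow_false_of_not_hullCell`**: under p462895's hypotheses, `¬ HStarLatticeLevelWindow X tq t`; and the
unramified-odd instance **`hStarLatticeLevelWindow_false_of_unramified`** (`e_w = 1`, radii `(1, 1)` since `Λ_w = log_p 𝒪_w^× = p𝒪_w`, label
`i+1 ≥ 2`, `P ≥ 1`: `HullCell 1 P (i+1) 1 1 ⟺ (i+1)²·P ≤ P` fails) — the refutation family of record (F = ℚ / S-RAT,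
`Cor312LicenceSharpRat.not_pilotKummerCompatHull_settingPrVolSharp_rat_of_qPinned`) reaches row 18 THROUGH THE LICENCE DOOR.
READING for the tables (neutral; tester line abc-iut-rh-tst-4 19:41:59Z): on R-W's WINDOW-TABLE v4.10 (sha16 11de60fe7e146c98) the NEG
criterion of p462895 at typ-4's radii `(⌊e_w/(p−1)⌋+1, min_t(p^t − t·e_w))` holds on exactly the 612 tame `CELL-REFUTED` packets (refuted label
sets identical) and on none of the 1751 tame `CELL-INHABITED` ones; by this file H⋆₁₈ is therefore FALSE at every datum carrying one of those 612
packets once the three local inputs `(hcin, hcout, hd)` are discharged for its local type — no table needed. Four `decide` cells calibrate the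
integer predicate (S-RAT shape; the GENUINE-PINNED packet `G-HEX-k9-l11-ev10`).
[cite: Mochizuki2012, IUTchIII Cor. 3.12 p. 173–174, Step (xi-f) p. 184; Thm. 3.11 (i) (Ind2) p. 154; IUTchIV Prop. 1.2 (i)(ii) p. 10]
[cite: DupuyHilado2025, §3.4, §3.9, §4.9, §4.12] [claim: Mochizuki2012, status: disputed] for every IUT sentence quoted. Axioms: standard.
-/

noncomputable section

open Set Function
open scoped Pointwise TensorProduct

namespace Summit.ABC.IUTFork.Repair.RH.LatticeLevelWindowRefute

open Summit.ABC.IUTFork.Thm311 Summit.ABC.IUTFork.Thm311.Real Summit.ABC.IUTFork.Cor312 Summit.ABC.IUTFork.Cor312.Setting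
  Summit.ABC.IUTFork.Cor312Vol Literature.IUT.LogThetaLattice Literature.IUT.LogVolume NumberField IsDedekindDomain
open Literature.NumberTheory.NumberFields Literature.NumberTheory.GaloisRepresentations.Ultrametric
open Summit.ABC.IUTFork.Repair.RH.HullThresholdExact Summit.ABC.IUTFork.Repair.RH.HullThresholdExactRefute
open Summit.ABC.IUTFork.Repair.RH.LatticeLevelWindow


variable {F : Type} [Field F] [NumberField F] (X : PilotData F) {logv : PadicLogs F} (hlog : LogvAnalytic logv)
  (M : Type) [Field M] [NumberField M]
  (archPk : ∀ (j : (thetaIndex X).Label) (vQ : (thetaIndex X).VQ), Set ((logShellsDH X logv).Packet j vQ))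
  (archSub : ∀ (j : (thetaIndex X).Label) (v : (thetaIndex X).V),
    Set ((logShellsDH X logv).Packet j ((thetaIndex X).over v)))
  (Ψ : ℤ → ∀ v : (thetaIndex X).V, v ∈ (thetaIndex X).Vbad → Set ((logShellsDH X logv).StarPacket v))
  (act : ℤ → ∀ v : (thetaIndex X).V, v ∈ (thetaIndex X).Vbad →
    (logShellsDH X logv).StarPacket v → Module.End ℚ ((logShellsDH X logv).StarPacket v))
  (Mmod : ℤ → ∀ j : (thetaIndex X).LabelStar, Set ((logShellsDH X logv).GlobalPacket j.1))
  (region : ℤ → ∀ j : (thetaIndex X).LabelStar, FinDivisor M → ∀ vQ : (thetaIndex X).VQ,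
    Set ((logShellsDH X logv).Packet j.1 vQ))
  (n : ℤ) {HT : Type} {LogLink : HT → HT → Type} {IsFull : ∀ {s t : HT}, LogLink s t → Prop}
  (lat : LGPGaussianLogThetaLattice LogLink IsFull)
  {Frd : Type} {IsoF : Frd → Frd → Type} {Ob : Frd → Type} {realify : Frd → Frd} {Strip : Type}
  {IsoS : Strip → Strip → Type} {Mv : ∀ v : (thetaIndex X).V, v ∈ (thetaIndex X).Vbad → Type}
  [∀ v h, Monoid (Mv v h)]
  (sig : GlobalLGPFrobenioidSignature (thetaIndex X).lstar (thetaIndex X).V (· ∈ (thetaIndex X).Vbad)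
    Frd IsoF Ob realify Strip IsoS Mv)
  (split : SplittingMonoids Mv) {ObΔ : Type} {N : ∀ v : (thetaIndex X).V, v ∈ (thetaIndex X).Vbad → Type}
  [∀ v h, Monoid (N v h)] (qData : QPilotData ObΔ N)
  (tq : ∀ (pp : Nat.Primes) (x : (thetaIndex X).Fibre (.inr pp)), haveI : Fact (pp : ℕ).Prime := ⟨pp.2⟩; kOf X pp.1 x)
  (t : ∀ (pp : Nat.Primes) (_ : Fin X.lstar) (x : (thetaIndex X).Fibre (.inr pp)),
    haveI : Fact (pp : ℕ).Prime := ⟨pp.2⟩; kOf X pp.1 x)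
  (htq0 : ∀ pp x, tq pp x ≠ 0)
  (htq1 : ∀ (pp : Nat.Primes) (x : (thetaIndex X).Fibre (.inr pp)),
    haveI : Fact (pp : ℕ).Prime := ⟨pp.2⟩; placeOf X pp.1 x ∉ X.S → ‖tq pp x‖ = 1)
  (col : ℤ → Column (logShellsDH X logv))
  (ht0 : ∀ pp i x, t pp i x ≠ 0)
  (ht : ∀ (pp : Nat.Primes) (i : Fin X.lstar) (x : (thetaIndex X).Fibre (.inr pp)),
    haveI : Fact (pp : ℕ).Prime := ⟨pp.2⟩
    Real.log ‖t pp i x‖ = -(X.thetaPilot i (placeOf X pp.1 x)) * logNorm F (placeOf X pp.1 x) /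
      localDegree F (placeOf X pp.1 x))
  (htq : ∀ (pp : Nat.Primes) (x : (thetaIndex X).Fibre (.inr pp)),
    haveI : Fact (pp : ℕ).Prime := ⟨pp.2⟩
    Real.log ‖tq pp x‖ = -(X.qPilot (placeOf X pp.1 x)) * logNorm F (placeOf X pp.1 x) /
      localDegree F (placeOf X pp.1 x))
  (cin cout : ∀ (pp : Nat.Primes) (x : (thetaIndex X).Fibre (.inr pp)),
    haveI : Fact (pp : ℕ).Prime := ⟨pp.2⟩; (presAt X hlog pp).k x)
  (hin0 : ∀ pp x, cin pp x ≠ 0)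
  (hin : ∀ (pp : Nat.Primes) (x : (thetaIndex X).Fibre (.inr pp)), haveI : Fact (pp : ℕ).Prime := ⟨pp.2⟩;
    ∀ o : (presAt X hlog pp).k x, ‖o‖ ≤ 1 → cin pp x * o ∈ logUnits ((presAt X hlog pp).k x))
  (hmax : ∀ (pp : Nat.Primes) (x : (thetaIndex X).Fibre (.inr pp)), haveI : Fact (pp : ℕ).Prime := ⟨pp.2⟩;
    ∃ (ϖ : ((presAt X hlog pp).k x)ˣ) (w : (presAt X hlog pp).k x),
      IsUniformizer ϖ ∧ w ∉ logUnits ((presAt X hlog pp).k x) ∧ ‖w‖ * ‖(ϖ : (presAt X hlog pp).k x)‖ ≤ ‖cin pp x‖)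
  (hout0 : ∀ pp x, cout pp x ≠ 0)
  (houtΛ : ∀ (pp : Nat.Primes) (x : (thetaIndex X).Fibre (.inr pp)), haveI : Fact (pp : ℕ).Prime := ⟨pp.2⟩;
    cout pp x ∈ logUnits ((presAt X hlog pp).k x))
  (hdom : ∀ (pp : Nat.Primes) (x : (thetaIndex X).Fibre (.inr pp)), haveI : Fact (pp : ℕ).Prime := ⟨pp.2⟩;
    ∀ z ∈ logUnits ((presAt X hlog pp).k x), ‖z‖ ≤ ‖cout pp x‖)


include hlog M archPk archSub Ψ act Mmod region n lat sig split qData htq0 htq1 col ht0 ht htq hin0 hin hmax hout0 houtΛ hdom in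
/-- **ROW 18's CANDIDATE IS FALSE WHEREVER ROW 4's COLUMN FAILS AT ONE TAME BAD PLACE (k3 of H⋆₁₈, theorem-level on the tame stratum).**
Under p462895's hypotheses (realising Θ- and q-ideles, abc-iut-w4-d036's radius binders, a tame-type place `w | p` with `P_q(w) = P`, certified
radii bounds `(hcin, hcout)`, different defect `(hd)`, and `¬ HullCell e_w P (i+1) r_in_ub r_out_lb`), `HStarLatticeLevelWindow X tq t` FAILS —
composition of p460671's sorry-free door `exists_qPinned_and_hull_settingPrVolSharp_of_levelWindow'` with p462895's
`not_exists_qPinned_and_hull_settingPrVolSharp_of_not_hullCell`. [cite: DupuyHilado2025, §3.9, §4.9, §4.12]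
[cite: Mochizuki2012, IUTchIII Cor. 3.12 Step (xi-f) p. 184; Thm. 3.11 (i) (Ind2) p. 154] [claim: Mochizuki2012, status: disputed] -/
theorem hStarLatticeLevelWindow_false_of_not_hullCell (pp : Nat.Primes) (i : Fin (thetaIndex X).lstar)
    (w : (thetaIndex X).Fibre (.inr pp)) {P : ℕ}
    (hP : haveI : Fact (pp : ℕ).Prime := ⟨pp.2⟩; X.qPilot (placeOf X pp.1 w) = P)
    {rinUb routLb : ℤ}
    (hcin : haveI : Fact (pp : ℕ).Prime := ⟨pp.2⟩
      ((pp : ℕ) : ℝ) ^ (((-rinUb : ℤ) : ℝ) / ((ramIdx F (placeOf X pp.1 w) : ℤ) : ℝ)) ≤ ‖cin pp w‖)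
    (hcout : haveI : Fact (pp : ℕ).Prime := ⟨pp.2⟩
      ‖cout pp w‖ ≤ ((pp : ℕ) : ℝ) ^ (((-routLb : ℤ) : ℝ) / ((ramIdx F (placeOf X pp.1 w) : ℤ) : ℝ)))
    (hd : haveI : Fact (pp : ℕ).Prime := ⟨pp.2⟩
      ∀ J : DIdx (pp : ℕ) ((presAt X hlog pp).kk (fun _ : (thetaIndex X).Caps (Setting.labelSucc i) => w)),
        dSum (pp : ℕ) ((presAt X hlog pp).kk (fun _ : (thetaIndex X).Caps (Setting.labelSucc i) => w)) -
            differentOrd (pp : ℕ) (DFac (pp : ℕ) ((presAt X hlog pp).kk (fun _ : (thetaIndex X).Caps (Setting.labelSucc i) => w)) J) ≤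
          (((((i : ℕ) : ℤ) + 1) * ((ramIdx F (placeOf X pp.1 w) : ℤ) - 1) : ℤ) : ℝ) / ((ramIdx F (placeOf X pp.1 w) : ℤ) : ℝ))
    (hneg : haveI : Fact (pp : ℕ).Prime := ⟨pp.2⟩
      ¬ HullCell (ramIdx F (placeOf X pp.1 w) : ℤ) (P : ℤ) (((i : ℕ) : ℤ) + 1) rinUb routLb) :
    ¬ HStarLatticeLevelWindow X tq t := fun h =>
  not_exists_qPinned_and_hull_settingPrVolSharp_of_not_hullCell X hlog M archPk archSub Ψ act Mmod region n lat sig split qData tq t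
    htq0 htq1 col ht0 ht htq cin cout hin0 hin hmax hout0 houtΛ hdom pp i w hP hcin hcout hd hneg
    (exists_qPinned_and_hull_settingPrVolSharp_of_levelWindow' X hlog M archPk archSub Ψ act Mmod region n lat sig split qData tq t
      htq0 htq1 col h)

include hlog M archPk archSub Ψ act Mmod region n lat sig split qData htq0 htq1 col ht0 ht htq hin0 hin hmax hout0 houtΛ hdom in
/-- **THE UNRAMIFIED-ODD INSTANCE THROUGH THE SAME DOOR.** At an UNRAMIFIED place (`e_w = 1`) with radii bounds `(1, 1)` (`Λ_w = p𝒪_w`),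
label `i+1 ≥ 2` and `P ≥ 1`, the cell `HullCell 1 P (i+1) 1 1 ⟺ (i+1)²·P ≤ P` fails (integer arithmetic, inline), so
`HStarLatticeLevelWindow X tq t` FAILS: the refutation family of record (F = ℚ, S-RAT) reaches row 18 through p462895.
[cite: DupuyHilado2025, §4.9, §4.12] [claim: Mochizuki2012, status: disputed] -/
theorem hStarLatticeLevelWindow_false_of_unramified (pp : Nat.Primes) (i : Fin (thetaIndex X).lstar) (hi : 1 ≤ (i : ℕ))
    (w : (thetaIndex X).Fibre (.inr pp)) {P : ℕ} (hP1 : 1 ≤ P)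
    (hP : haveI : Fact (pp : ℕ).Prime := ⟨pp.2⟩; X.qPilot (placeOf X pp.1 w) = P)
    (he : haveI : Fact (pp : ℕ).Prime := ⟨pp.2⟩; ramIdx F (placeOf X pp.1 w) = 1)
    (hcin : haveI : Fact (pp : ℕ).Prime := ⟨pp.2⟩
      ((pp : ℕ) : ℝ) ^ (((-(1 : ℤ) : ℤ) : ℝ) / ((ramIdx F (placeOf X pp.1 w) : ℤ) : ℝ)) ≤ ‖cin pp w‖)
    (hcout : haveI : Fact (pp : ℕ).Prime := ⟨pp.2⟩
      ‖cout pp w‖ ≤ ((pp : ℕ) : ℝ) ^ (((-(1 : ℤ) : ℤ) : ℝ) / ((ramIdx F (placeOf X pp.1 w) : ℤ) : ℝ)))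
    (hd : haveI : Fact (pp : ℕ).Prime := ⟨pp.2⟩
      ∀ J : DIdx (pp : ℕ) ((presAt X hlog pp).kk (fun _ : (thetaIndex X).Caps (Setting.labelSucc i) => w)),
        dSum (pp : ℕ) ((presAt X hlog pp).kk (fun _ : (thetaIndex X).Caps (Setting.labelSucc i) => w)) -
            differentOrd (pp : ℕ) (DFac (pp : ℕ) ((presAt X hlog pp).kk (fun _ : (thetaIndex X).Caps (Setting.labelSucc i) => w)) J) ≤
          (((((i : ℕ) : ℤ) + 1) * ((ramIdx F (placeOf X pp.1 w) : ℤ) - 1) : ℤ) : ℝ) / ((ramIdx F (placeOf X pp.1 w) : ℤ) : ℝ)) :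
    ¬ HStarLatticeLevelWindow X tq t := by
  refine hStarLatticeLevelWindow_false_of_not_hullCell X hlog M archPk archSub Ψ act Mmod region n lat sig split qData tq t htq0 htq1 col
    ht0 ht htq cin cout hin0 hin hmax hout0 houtΛ hdom pp i w hP hcin hcout hd ?_
  rw [he]
  unfold HullCell
  push_cast
  rw [Int.ediv_one]
  intro h
  have hi' : (1 : ℤ) ≤ ((i : ℕ) : ℤ) := by exact_mod_cast hi
  have hP' : (1 : ℤ) ≤ (P : ℤ) := by exact_mod_cast hP1
  nlinarith [mul_le_mul_of_nonneg_right hi' (le_trans zero_le_one hP'), sq_nonneg ((i : ℕ) : ℤ), mul_nonneg (le_trans zero_le_one hi') (le_trans zero_le_one hP')]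

/-- Numeric sanity (decidable): the S-RAT-shaped cell `e = 1, P = 1, j = 2, radii (1,1)` is NEG, `j = 1` is POS. [folklore] -/
example : ¬ HullCell 1 1 2 1 1 := by unfold HullCell; decide

example : HullCell 1 1 1 1 1 := by unfold HullCell; decide

/-- One GENUINE-PINNED G-HEX packet of WINDOW-TABLE v4.10 11de60fe7e146c98, row `G-HEX-k9-l11-ev10` (p = 7, e_w = 110, m_q = 90,
l⋆ = 5, certified radii (r_in_ub, r_out♯) = (19, −171)): the top-label cell j = 5 is NEG (110·⌊1591/110⌋ = 1540 > 90 + 6·171 = 1116),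
exactly col 46 `labels_refuted_U2cell = 5` of that row. [folklore] -/
example : ¬ HullCell 110 90 5 19 (-171) := by unfold HullCell; decide

/-- … and its label j = 4 is POS (110·⌊930/110⌋ = 880 ≤ 90 + 5·171 = 945), as the table says (only label 5 refuted). [folklore] -/
example : HullCell 110 90 4 19 (-171) := by unfold HullCell; decide

end Summit.ABC.IUTFork.Repair.RH.LatticeLevelWindowRefute

end
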